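/-
Copyright (c) 2026 the pub-hodgecm-mathlib formalisation cell (harness21).  Prover seat hodgecm-mathlib-K2E3-p17 (g11), HCML Track B «K2-LIT» ∕ h413
(`stmt-HodgeConjecture-24833`), R90-TF section S3, (U3-F) brick P3a «the SPREAD MODEL: real-rootedness with a PINNED constant term under a perturbation of
prescribed size» (dealer R90-C12-plan (g2) RECONCILIATION 2026-09-05T00:40:15Z: P3a+P3b → K2E3-p17; design = captain's census (C3) = audit1 S3#71 (C)).
2026-09-05.
-/
import Summits.HodgeConjecture.HodgeConjecture.Theorems.R90S3SpreadModelNodes   -- ★ P3a part 1: the model, nodes, bounds (+ ★ T3 transitively)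
import Mathlib.Analysis.Complex.Polynomial.Basic
import HarnessLib

/-!
# R90-TF · S3 · THEOREMS — `R90S3SpreadModelRealRooted` ((U3-F) brick P3a, part 2∕2): a monic real polynomial whose middle coefficients are within `B` of those
# of the SPREAD MODEL `(X + t)(X + T)⋯(X + T^{d−1})` (`T ≥ 2^{d+1} d (B+1)`, `0 < t ≤ 1`) and whose constant term EQUALS the model's has `d` simple NEGATIVE roots

R90-TF section S3 (dealer R90-C12-plan (g2), memo `DEAL-S3-U3F-SPLIT.v2.md` row P3; captain's census `R90/S3/CENSUS-U3F-assembly.K2E3-p17-g11.md` §3 (C3));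
crux H413 (`stmt-HodgeConjecture-24833`, lane `--supports … --as helper`), route `HCCMUnconditional`.  Serves the CRT step P3b (`R90S3PlantedPolynomial`):
P3b must produce a monic `g ∈ ℤ[X]` with middle coefficients in prescribed classes modulo `Q`, constant term EXACTLY `pᵃ` (census (C0)), and ALL ROOTS REAL,
SIMPLE and NEGATIVE (`F′ = ℚ(α)` totally real, `α` totally negative, ★ P7).  A T3 ε-box is far smaller than `Q`; the spread model's alternation margins
EXCEED any `B` once `T ≥ 2^{d+1} d (B+1)` (part 1 ★ `R90S3SpreadModelNodes`: node bounds; ★ T3: alternation ⇒ roots).  PURE MATHLIB + ★; THEOREMS ONLY (no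
`def`, no `instance`, no notation, no named fact, no `sorry`); never imports `Cruxes/…/Lines`.

THE MATHEMATICS [folklore].  With the model `g`, roots `a`, nodes `x` of part 1 and `2^{d+1} d (B+1) ≤ T`: for `f` monic of degree `d` with `f(0) = g(0)` and
`|f_k − g_k| ≤ B` (`0 < k < d`), `|f(x_i) − g(x_i)| ≤ B (d−1) |x_i|^{d−1} < |g(x_i)|` at every node (`B(d−1)2^{d−1} < T∕2 ≤ T^m, (T∕2)^{d−1}`; at `x_d = 0` the
difference vanishes and `g(0) ≠ 0`), so `f` alternates (★ T3 `sign_alternation_of_abs_sub_lt`), has `d` distinct real roots — one per gap, hence ALL of them, all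
`< x_d = 0` — splits over `ℝ`, and every complex root is a negative real.  §4 packages the model: `t := c₀ ∕ (T·T²⋯T^{d−1})`.
* §3 **`sign_alternation_of_near_spreadModel`**, **`card_roots_toFinset_eq_of_near_spreadModel`**, `card_roots_eq_of_near_spreadModel`, `splits_of_near_spreadModel`,
  **`roots_neg_of_near_spreadModel`**, **`complex_roots_of_near_spreadModel`**.
* §4 **`exists_spreadModel`** — for `d ≥ 2`, `B ≥ 0`, `c₀ > 0`, `T ≥ max (4, c₀, 2^{d+1} d (B+1))` a monic `g ∈ ℝ[X]` of degree `d` with `g(0) = c₀` such that EVERY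
  monic `f` of degree `d` with `f(0) = c₀` and `|f_k − g_k| ≤ B` (`0 < k < d`) has `d` distinct real roots, splits, and has all real and complex roots negative real.

HONEST LABEL: HC_CM is proved only modulo the 7 printed citations (2 remaining named inputs: hLiu418 = stmt-HodgeConjecture-24832, h413 =
stmt-HodgeConjecture-24833) until rung 0 closes; elementary real analysis for a sub-step of a GENUINE residual ((U3-F)); proves nothing printed; count-neutral.
References: [Rogawski1990] §13.8 p. 216 (the auxiliary totally real field); [CasselsFrohlichANT1967] Ch. II §6 (approximation ∕ CRT — the consumer P3b).
-/

set_option autoImplicit false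
-- the mandated namespace repeats the single-problem summit's segment (`HodgeConjecture.HodgeConjecture`)
set_option linter.dupNamespace false

noncomputable section

namespace Summit.HodgeConjecture.HodgeConjecture.R90.S3

open Polynomial Finset

/-! ## §3 A monic perturbation of the spread model with pinned constant term is real-rooted with negative roots -/

section Main

variable {d : ℕ} (hd : 2 ≤ d) {T t B : ℝ} (hT : 4 ≤ T) (ht0 : 0 < t) (ht1 : t ≤ 1) (hB : 0 ≤ B) (hTB : 2 ^ (d + 1) * d * (B + 1) ≤ T)
  (a : Fin d → ℝ) (ha : ∀ j : Fin d, a j = if (j : ℕ) + 1 < d then -T ^ (d - 1 - j) else -t)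
  (x : Fin (d + 1) → ℝ) (hx : ∀ i : Fin (d + 1), x i = if (i : ℕ) < d then -2 * T ^ (d - 1 - i) else 0)
  (f : ℝ[X]) (hfm : f.Monic) (hfd : f.natDegree = d) (h0 : f.coeff 0 = (∏ j, (X - C (a j))).coeff 0)
  (hmid : ∀ k, 0 < k → k < d → |f.coeff k - (∏ j, (X - C (a j))).coeff k| ≤ B)

include hd hB hTB in
/-- The numerical heart: `B (d − 1) 2^{d−1} < T ∕ 2` under `2^{d+1} d (B + 1) ≤ T`. [folklore] -/
private theorem key_ineq : B * (d - 1 : ℕ) * 2 ^ (d - 1) < T / 2 := by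
  have hd' : (2 : ℝ) ≤ d := by exact_mod_cast hd
  have hcast : ((d - 1 : ℕ) : ℝ) = (d : ℝ) - 1 := by rw [Nat.cast_sub (by omega : 1 ≤ d), Nat.cast_one]
  rw [hcast]
  have h2 : (2 : ℝ) ^ (d + 1) = 2 ^ (d - 1) * 4 := by
    rw [show d + 1 = (d - 1) + 2 by omega, pow_add]; norm_num
  have h3 : (0 : ℝ) < 2 ^ (d - 1) := by positivity
  have h5 : B * ((d : ℝ) - 1) < 2 * d * (B + 1) := by nlinarith
  calc B * ((d : ℝ) - 1) * 2 ^ (d - 1) < (2 * d * (B + 1)) * 2 ^ (d - 1) := mul_lt_mul_of_pos_right h5 h3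
    _ = 2 ^ (d + 1) * d * (B + 1) / 2 := by rw [h2]; ring
    _ ≤ T / 2 := by linarith

include hd hT ht0 ht1 hB hTB ha hx hfm hfd h0 hmid in
/-- **A monic perturbation of the spread model alternates at the nodes**: if `f` is monic of degree `d`, `f(0) = g(0)` and `|f_k − g_k| ≤ B` for `0 < k < d`,
then `f` has the strict sign of `g` at each node (`|f(x_i) − g(x_i)| < |g(x_i)|`, ★ T3 `sign_alternation_of_abs_sub_lt`), so it alternates. [folklore] -/
theorem sign_alternation_of_near_spreadModel (i : Fin d) : f.eval (x i.castSucc) * f.eval (x i.succ) < 0 := by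
  have hTpos : 0 < T := by linarith
  have hT1 : 1 ≤ T := by linarith
  set g : ℝ[X] := ∏ j, (X - C (a j)) with hgdef
  have hgm : g.Monic := monic_prod_of_monic _ _ fun j _ => monic_X_sub_C (a j)
  have hgdeg : g.natDegree = d := by
    rw [hgdef, natDegree_prod_of_monic _ _ fun j _ => monic_X_sub_C (a j)]
    simp
  have hf1 : f.coeff d = 1 := by have h := hfm.coeff_natDegree; rwa [hfd] at h
  have hg1 : g.coeff d = 1 := by have h := hgm.coeff_natDegree; rwa [hgdeg] at h
  have htop : f.coeff d = g.coeff d := by rw [hf1, hg1]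
  have hkey := key_ineq hd hB hTB
  refine sign_alternation_of_abs_sub_lt f g x (spreadModel_sign_alternation hT ht0 ht1 a ha x hx) (fun i' => ?_) i
  by_cases hi' : (i' : ℕ) < d
  · -- a negative node `x = −2 T^m`
    have hxi : x i' = -2 * T ^ (d - 1 - (i' : ℕ)) := by rw [hx i', if_pos hi']
    have hTm : 1 ≤ T ^ (d - 1 - (i' : ℕ)) := one_le_pow₀ hT1
    have habs : |x i'| = 2 * T ^ (d - 1 - (i' : ℕ)) := by
      rw [hxi, abs_of_nonpos (by linarith)]; ring
    have hx1 : 1 ≤ |x i'| := by rw [habs]; linarith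
    have hpert := abs_eval_sub_eval_le_of_middle_coeff f g hfd.le hgdeg.le htop h0 hB hmid hx1
    by_cases hm : (i' : ℕ) + 1 < d
    · -- `m ≥ 1`: `B (d−1) (2T^m)^{d−1} < T^m · (T^m)^{d−1} = (T^m)^d ≤ |g(x)|`
      have hlow := abs_eval_spreadModel_spreadNode_ge hT ht1 a ha x hx i' hi'
      have hTm' : T ≤ T ^ (d - 1 - (i' : ℕ)) := by
        calc T = T ^ 1 := (pow_one T).symm
          _ ≤ T ^ (d - 1 - (i' : ℕ)) := pow_le_pow_right₀ hT1 (by omega)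
      have hsplit : (T ^ (d - 1 - (i' : ℕ))) ^ d = T ^ (d - 1 - (i' : ℕ)) * (T ^ (d - 1 - (i' : ℕ))) ^ (d - 1) := by
        rw [← pow_succ', Nat.sub_add_cancel (by omega : 1 ≤ d)]
      have hpow : |x i'| ^ (d - 1) = 2 ^ (d - 1) * (T ^ (d - 1 - (i' : ℕ))) ^ (d - 1) := by rw [habs, mul_pow]
      have hpos : 0 < (T ^ (d - 1 - (i' : ℕ))) ^ (d - 1) := by positivity
      calc |f.eval (x i') - g.eval (x i')| ≤ B * (d - 1 : ℕ) * |x i'| ^ (d - 1) := hpert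
        _ = (B * (d - 1 : ℕ) * 2 ^ (d - 1)) * (T ^ (d - 1 - (i' : ℕ))) ^ (d - 1) := by rw [hpow]; ring
        _ < T ^ (d - 1 - (i' : ℕ)) * (T ^ (d - 1 - (i' : ℕ))) ^ (d - 1) := by
            apply mul_lt_mul_of_pos_right _ hpos
            linarith
        _ = (T ^ (d - 1 - (i' : ℕ))) ^ d := hsplit.symm
        _ ≤ |g.eval (x i')| := hlow
    · -- the last negative node `x = −2`: `B (d−1) 2^{d−1} < T∕2 ≤ (T∕2)^{d−1} ≤ |g(−2)|`
      have hi1 : (i' : ℕ) + 1 = d := by omega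
      have hlow := abs_eval_spreadModel_neg_two_ge hT ht1 a ha x hx i' hi1
      have habs2 : |x i'| = 2 := by rw [habs, show d - 1 - (i' : ℕ) = 0 by omega, pow_zero, mul_one]
      have hT2 : T / 2 ≤ (T / 2) ^ (d - 1) := le_self_pow₀ (by linarith) (by omega)
      calc |f.eval (x i') - g.eval (x i')| ≤ B * (d - 1 : ℕ) * |x i'| ^ (d - 1) := hpert
        _ = B * (d - 1 : ℕ) * 2 ^ (d - 1) := by rw [habs2]
        _ < T / 2 := hkey
        _ ≤ (T / 2) ^ (d - 1) := hT2
        _ ≤ |g.eval (x i')| := hlow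
  · -- the node `x_d = 0`: `f(0) = g(0) ≠ 0`
    have hxi : x i' = 0 := by rw [hx i', if_neg hi']
    have hfg0 : f.eval 0 = g.eval 0 := by rw [← coeff_zero_eq_eval_zero, ← coeff_zero_eq_eval_zero, h0]
    have hg0 : g.eval 0 ≠ 0 := by
      rw [hgdef, eval_prod]
      refine prod_ne_zero_iff.2 fun j _ => ?_
      rw [eval_sub, eval_X, eval_C, zero_sub, neg_ne_zero, ha j]
      split_ifs
      · exact neg_ne_zero.2 (pow_ne_zero _ hTpos.ne')
      · exact neg_ne_zero.2 ht0.ne'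
    rw [hxi, hfg0, sub_self, abs_zero]
    exact abs_pos.2 hg0

include hd hT ht0 ht1 hB hTB ha hx hfm hfd h0 hmid in
/-- **`d` distinct real roots** (★ T3 `card_roots_toFinset_eq_of_sign_alternation`). [folklore] -/
theorem card_roots_toFinset_eq_of_near_spreadModel : f.roots.toFinset.card = d :=
  card_roots_toFinset_eq_of_sign_alternation f x (spreadNodes_strictMono hT x hx)
    (sign_alternation_of_near_spreadModel hd hT ht0 ht1 hB hTB a ha x hx f hfm hfd h0 hmid) hfd

include hd hT ht0 ht1 hB hTB ha hx hfm hfd h0 hmid in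
/-- **All `d` roots real, counted with multiplicity** (★ T3 `card_roots_eq_of_sign_alternation`). [folklore] -/
theorem card_roots_eq_of_near_spreadModel : Multiset.card f.roots = d :=
  card_roots_eq_of_sign_alternation f x (spreadNodes_strictMono hT x hx)
    (sign_alternation_of_near_spreadModel hd hT ht0 ht1 hB hTB a ha x hx f hfm hfd h0 hmid) hfd

include hd hT ht0 ht1 hB hTB ha hx hfm hfd h0 hmid in
/-- **`f` splits over `ℝ`** (★ T3 `splits_of_sign_alternation`). [folklore] -/
theorem splits_of_near_spreadModel : f.Splits :=
  splits_of_sign_alternation f x (spreadNodes_strictMono hT x hx)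
    (sign_alternation_of_near_spreadModel hd hT ht0 ht1 hB hTB a ha x hx f hfm hfd h0 hmid) hfd

include hd hT ht0 ht1 hB hTB ha hx hfm hfd h0 hmid in
/-- **Every real root is negative**: the `d` roots found in the `d` gaps between consecutive nodes (★ T3 `exists_isRoot_mem_Ioo_of_sign_alternation`) are
distinct, hence ALL the roots (`#roots ≤ d`), and every gap lies left of the last node `x_d = 0`. [folklore] -/
theorem roots_neg_of_near_spreadModel : ∀ r ∈ f.roots, r < 0 := by
  classical
  have hmono := spreadNodes_strictMono hT x hx
  have halt := sign_alternation_of_near_spreadModel hd hT ht0 ht1 hB hTB a ha x hx f hfm hfd h0 hmid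
  have hcard := card_roots_toFinset_eq_of_sign_alternation f x hmono halt hfd
  choose r hr using fun i : Fin d => exists_isRoot_mem_Ioo_of_sign_alternation f x hmono halt i
  -- the chosen roots increase, hence are distinct
  have hrmono : StrictMono r := by
    intro i j hij
    calc r i < x i.succ := (hr i).1.2
      _ ≤ x j.castSucc := hmono.monotone (Fin.succ_le_castSucc_iff.2 hij)
      _ < r j := (hr j).1.1
  have hsub : univ.image r ⊆ f.roots.toFinset := by
    intro s hs
    obtain ⟨i, -, rfl⟩ := mem_image.1 hs
    exact Multiset.mem_toFinset.2 ((mem_roots hfm.ne_zero).2 (hr i).2)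
  have heq : univ.image r = f.roots.toFinset :=
    eq_of_subset_of_card_le hsub (by rw [hcard, card_image_of_injective _ hrmono.injective, card_univ, Fintype.card_fin])
  intro ρ hρ
  have hρ' : ρ ∈ univ.image r := by rw [heq]; exact Multiset.mem_toFinset.2 hρ
  obtain ⟨i, -, rfl⟩ := mem_image.1 hρ'
  calc r i < x i.succ := (hr i).1.2
    _ ≤ x (Fin.last d) := hmono.monotone (Fin.le_last _)
    _ = 0 := by rw [hx (Fin.last d), Fin.val_last, if_neg (lt_irrefl d)]

include hd hT ht0 ht1 hB hTB ha hx hfm hfd h0 hmid in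
/-- **Every complex root is a negative real number**: `f` splits over `ℝ`, so the complex roots are the images of the real ones (Mathlib
`roots_map_of_injective_of_card_eq_natDegree`). [folklore] -/
theorem complex_roots_of_near_spreadModel (z : ℂ) (hz : (f.map (algebraMap ℝ ℂ)).IsRoot z) : z.im = 0 ∧ z.re < 0 := by
  have hcard : Multiset.card f.roots = f.natDegree := by
    rw [card_roots_eq_of_near_spreadModel hd hT ht0 ht1 hB hTB a ha x hx f hfm hfd h0 hmid, hfd]
  have hroots : (f.map (algebraMap ℝ ℂ)).roots = f.roots.map (algebraMap ℝ ℂ) :=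
    (roots_map_of_injective_of_card_eq_natDegree (algebraMap ℝ ℂ).injective hcard).symm
  have hz' : z ∈ (f.map (algebraMap ℝ ℂ)).roots := (mem_roots (hfm.map _).ne_zero).2 hz
  rw [hroots, Multiset.mem_map] at hz'
  obtain ⟨r, hr, rfl⟩ := hz'
  exact ⟨Complex.ofReal_im r, by
    rw [Complex.coe_algebraMap, Complex.ofReal_re]
    exact roots_neg_of_near_spreadModel hd hT ht0 ht1 hB hTB a ha x hx f hfm hfd h0 hmid r hr⟩

end Main

/-! ## §4 The packaged form consumed by P3b: only `d, B, c₀, T` appear -/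

/-- **The spread model with pinned constant term.**  For `d ≥ 2`, `B ≥ 0`, `c₀ > 0` and `T ≥ max (4, c₀, 2^{d+1} d (B+1))` there is a monic `g ∈ ℝ[X]` of
degree `d` with `g(0) = c₀` — namely `(X + t)(X + T)⋯(X + T^{d−1})` with `t := c₀ ∕ (T·T²⋯T^{d−1}) ∈ (0, 1]` — such that EVERY monic `f ∈ ℝ[X]` of degree `d`
with `f(0) = c₀` and `|f_k − g_k| ≤ B` for `0 < k < d` has `d` distinct real roots, splits over `ℝ`, has all its real roots `< 0`, and has every complex root
`z` real and negative (`z.im = 0`, `z.re < 0`).  (P3b takes `B :=` the CRT modulus and rounds the middle coefficients of `g` into the prescribed classes.)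
[folklore] -/
theorem exists_spreadModel {d : ℕ} (hd : 2 ≤ d) {B c₀ T : ℝ} (hB : 0 ≤ B) (hc₀ : 0 < c₀) (hT : 4 ≤ T) (hTB : 2 ^ (d + 1) * d * (B + 1) ≤ T)
    (hc₀T : c₀ ≤ T) :
    ∃ g : ℝ[X], g.Monic ∧ g.natDegree = d ∧ g.coeff 0 = c₀ ∧
      ∀ f : ℝ[X], f.Monic → f.natDegree = d → f.coeff 0 = c₀ → (∀ k, 0 < k → k < d → |f.coeff k - g.coeff k| ≤ B) →
        f.roots.toFinset.card = d ∧ f.Splits ∧ (∀ r ∈ f.roots, r < 0) ∧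
          ∀ z : ℂ, (f.map (algebraMap ℝ ℂ)).IsRoot z → z.im = 0 ∧ z.re < 0 := by
  have hTpos : 0 < T := by linarith
  have hT1 : 1 ≤ T := by linarith
  obtain ⟨n, hn⟩ : ∃ n, d = n + 1 := ⟨d - 1, by omega⟩
  -- the product of the large roots and the small root `t`
  set P : ℝ := ∏ j : Fin n, T ^ (n - (j : ℕ)) with hPdef
  have hn1 : 1 ≤ n := by omega
  have hPT : T ≤ P := by
    -- every factor is `≥ 1` and the factor `j = 0` is `T^n ≥ T`
    have h1 : ∀ j : Fin n, 1 ≤ T ^ (n - (j : ℕ)) := fun j => one_le_pow₀ hT1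
    have hsingle : (∏ j : Fin n, if (⟨0, hn1⟩ : Fin n) = j then T else (1 : ℝ)) = T := by
      rw [prod_ite_eq]; simp
    calc T = ∏ j : Fin n, if (⟨0, hn1⟩ : Fin n) = j then T else (1 : ℝ) := hsingle.symm
      _ ≤ P := by
          rw [hPdef]
          refine prod_le_prod (fun j _ => by split_ifs <;> positivity) fun j _ => ?_
          split_ifs with hj
          · subst hj
            calc T = T ^ 1 := (pow_one T).symm
              _ ≤ T ^ (n - ((⟨0, hn1⟩ : Fin n) : ℕ)) := pow_le_pow_right₀ hT1 (by simp; omega)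
          · exact h1 j
  have hPpos : 0 < P := lt_of_lt_of_le hTpos hPT
  set t : ℝ := c₀ / P with htdef
  have ht0 : 0 < t := div_pos hc₀ hPpos
  have ht1 : t ≤ 1 := by rw [htdef, div_le_one hPpos]; exact hc₀T.trans hPT
  -- roots and nodes
  set a : Fin d → ℝ := fun j => if (j : ℕ) + 1 < d then -T ^ (d - 1 - (j : ℕ)) else -t with hadef
  set x : Fin (d + 1) → ℝ := fun i => if (i : ℕ) < d then -2 * T ^ (d - 1 - (i : ℕ)) else 0 with hxdef
  have ha : ∀ j : Fin d, a j = if (j : ℕ) + 1 < d then -T ^ (d - 1 - (j : ℕ)) else -t := fun j => rfl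
  have hx : ∀ i : Fin (d + 1), x i = if (i : ℕ) < d then -2 * T ^ (d - 1 - (i : ℕ)) else 0 := fun i => rfl
  have hgm : (∏ j, (X - C (a j))).Monic := monic_prod_of_monic _ _ fun j _ => monic_X_sub_C (a j)
  have hgdeg : (∏ j, (X - C (a j))).natDegree = d := by
    rw [natDegree_prod_of_monic _ _ fun j _ => monic_X_sub_C (a j)]
    simp
  -- the constant term: `∏ (−a_j) = P · t = c₀`
  have hg0 : (∏ j, (X - C (a j))).coeff 0 = c₀ := by
    rw [coeff_zero_prod]
    simp only [coeff_sub, coeff_X_zero, coeff_C_zero, zero_sub]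
    subst hn
    rw [Fin.prod_univ_castSucc]
    have hlast : -a (Fin.last n) = t := by
      rw [ha (Fin.last n), Fin.val_last, if_neg (lt_irrefl _), neg_neg]
    have hcast : ∀ j : Fin n, -a j.castSucc = T ^ (n - (j : ℕ)) := by
      intro j
      have hjv : ((j.castSucc : Fin (n + 1)) : ℕ) = j := rfl
      have hexp : n + 1 - 1 - (j : ℕ) = n - j := by omega
      rw [ha j.castSucc, hjv, if_pos (by omega), hexp, neg_neg]
    rw [hlast, prod_congr rfl fun j _ => hcast j, ← hPdef, htdef, mul_div_cancel₀ _ hPpos.ne']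
  refine ⟨∏ j, (X - C (a j)), hgm, hgdeg, hg0, fun f hfm hfd hf0 hmid => ?_⟩
  have h0 : f.coeff 0 = (∏ j, (X - C (a j))).coeff 0 := by rw [hf0, hg0]
  exact ⟨card_roots_toFinset_eq_of_near_spreadModel hd hT ht0 ht1 hB hTB a ha x hx f hfm hfd h0 hmid,
    splits_of_near_spreadModel hd hT ht0 ht1 hB hTB a ha x hx f hfm hfd h0 hmid,
    roots_neg_of_near_spreadModel hd hT ht0 ht1 hB hTB a ha x hx f hfm hfd h0 hmid,
    complex_roots_of_near_spreadModel hd hT ht0 ht1 hB hTB a ha x hx f hfm hfd h0 hmid⟩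

end Summit.HodgeConjecture.HodgeConjecture.R90.S3

end
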